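import Summits.BirchSwinnertonDyer.BirchSwinnertonDyer.Theorems.CumulativeHeegnerLeopoldtRedSplitControlAtThreeShaDualFiniteDuality
import Summits.BirchSwinnertonDyer.BirchSwinnertonDyer.Theorems.CumulativeHeegnerLeopoldtRedSplitControlAtThreeShaDualNewPlace
import Summits.BirchSwinnertonDyer.BirchSwinnertonDyer.Theorems.SchneiderFreeAdditiveX3PoitouTateBidualTransport
import HarnessLib

/-!
# Poitou–Tate: the annihilator of `Ш¹(K, M^D)` in `H¹(K, M^D)^*` is the image of `γ¹`
# (the algebraic half of Milne I Thm. 4.10 (a) `Ш²(K, M) ≅ Ш¹(K, M^D)^*`, from Thm. 4.10 (b) for Selmer structures)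

Cell `bsd-wall`, seat `bsd-line-chl-p2` g5 — WIDTH PROVER on crux K4 `RedSplitControlAtThree`
(stmt-BirchSwinnertonDyer-24200) of route `CumulativeHeegnerLeopoldt`, `--supports` that item.  K4 is landed
BY NAME modulo exactly the two Poitou–Tate named facts (`RedSplitControlAtThreeOfFacts.redSplitControlAtThree_of_poitouTate`):
PT1 `poitouTate_selmerStructure_duality` (item 20461; being discharged by Route A of cell `bsd-schneider`:
Tate's duality theorem for the idèle class formation + the readout of `P¹`) and PT2 `poitouTate_sha_tateDual`
(item 20462; Milne I 4.10 (a), `Ш²(K, M) × Ш¹(K, M^D) → ℤ/n` perfect; no owner so far), which K4 consumes only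
as the inequality `#Ш²(K, E[3^k]) ≤ #Ш¹(K, E[3^k]^D)` (weak-Leopoldt atom `H²(Γ_K, E[3^∞]) = 0`).  This file
proves, as KERNEL theorems over the tree's Galois cohomology, the step of Milne's proof of 4.10 (a) which is
pure "finite duality + Selmer structures", so that PT2 is reduced to the SAME Route-A input as PT1:

THE STATEMENT (`exists_family_sum_localTatePairing_eq`).  Let `inv` be a family of local invariant maps
with local Tate duality at the finite places (`IsPerfect`), Milne I Thm. 2.6 (`UnramifiedOrthogonal`) and
Poitou–Tate for Selmer structures (`SelmerComplement`, Howard Thm. 2.1.11 = Milne I 4.10 (b) `Ker γ¹ ⊆ Im β¹`);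
let `M` be a finite discrete `Γ_K`-module killed by `n`, unramified outside the finite `S₀ ⊇ {v ∣ ∞} ∪ {v ∣ n}`,
`M^D = Hom(M, μₙ)`.  Then for EVERY additive `φ : H¹(K, M^D) → ℤ/n` vanishing on the classes that are
locally zero at all finite places (for `K` totally complex: vanishing on `Ш¹(K, M^D)`,
`exists_family_sum_localTatePairing_eq_of_isTotallyComplex`) there are a finite `S₁ ⊇ S₀` and ONE family
`t = (t_v)_v ∈ P¹(K, M)` (`t_v ∈ H¹(K_v, M)`, `t_w = 0` at `w ∣ ∞`, `t_v ∈ H¹_ur(K_v, M)` for `v ∉ S₁`) with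

  `φ(y) = ∑_{v ∈ S} inv_v (t_v ∪ y_v)`   for all `y ∈ H¹(K, M^D)` and all finite `S ⊇ S₁` off which `y`
  is unramified (the sum is `γ¹(t)(y)`; terms off `S` vanish, both classes being unramified).

That is: **`Ш¹(K, M^D)^⊥ ⊆ γ¹(P¹(K, M))` in `Hom(H¹(K, M^D), ℤ/n)`** — the converse inclusion being trivial.
WHY THIS IS THE MISSING HALF OF 4.10 (a): Route A gives (from `0 → K̄ˣ → J̄ → C̄ → 0`, Tate's `α¹` and the
readout) `Ш²(K, M) ≅ coker (P¹(K, M) —γ¹→ H¹(K, M^D)^*)`; with the present theorem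
`coker γ¹ = H¹(K, M^D)^*/Ш¹(K, M^D)^⊥ ≅ Ш¹(K, M^D)^*`, whence `#Ш²(K, M) = #Ш¹(K, M^D)` and the perfect
pairing.  (In Milne's proof this is the topological statement "`β¹(H¹(K, M^D))` is discrete, hence closed,
in the locally compact `P¹(K, M^D)`"; here it is proved algebraically.)

THE PROOF (§4).  (1) `exists_finset_forall_localization_eq_zero`: the groups
`Ш¹_S = {x : x_v = 0 (v ∈ S_f), x unramified off S}` decrease with `S` inside the finite `Ш¹_{S₀}`
(`SelmerFinite.finite_selmerGroup_of_isUnramifiedOutside`), so for `S₁` large `Ш¹_{S₁}(M) = Ш¹(M)` and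
`Ш¹_{S₁}(M^D) = Ш¹(M^D)` at the finite places.  (2) On `A₁ = {y unramified off S₁}` the functional `φ`
kills `ker (A₁ → ∏_{v ∈ S₁,f} H¹(K_v, M^D)) = Ш¹_{S₁}(M^D)`, so factors through the image and — the local
pairings summing to a PERFECT pairing of the finite products — is `∑_{v ∈ S₁,f} ⟨t¹_v, ·⟩` there
(`exists_apply_eq_of_bijective`, characters of a subgroup extend, by counting).  (3) For a finite `v₀ ∉ S₁`,
`H¹_{S₁ ∪ {v₀}}(K, M^D) ↠ H¹(K_{v₀}, M^D)/H¹_ur` (`exists_localization_sub_mem_unramifiedSubgroup`: Howard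
2.1.11 for `strict_{S₁∪{v₀}} ≤ strict_{S₁}` on `M`, whose `H¹ = Ш¹_{S₁}(M) = Ш¹(M)` pairs to zero with
everything, and `(H¹_ur)^* = H¹_ur`); hence `φ − ∑_{S₁,f}⟨t¹_v, ·⟩` restricted to those classes is a
functional on `H¹(K_{v₀}, M^D)/H¹_ur`, equal to `⟨t_{v₀}, ·⟩` for a unique `t_{v₀}`, which is unramified
(Milne I 2.6).  (4) Induction on the ramification of `y` off `S₁`, peeling one place at a time with (3).

HONEST FRAMING.  Theorems only (no definition, no named fact, no `sorry`, no instance); CONDITIONAL on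
nothing but its displayed hypotheses (the three PT1 properties of the family); closes no item by itself;
the Summits-side K4 / UTD #5 / SOED / 19295 consumers still need PT2 itself (or its counting half) —
this is infrastructure toward it, filed `--supports stmt-BirchSwinnertonDyer-24200`.  BSD is not proved
by any of this.

References: [MilneADT2006] I Cor. 2.3, Thm. 2.6, Lemma 4.8, Thm. 4.10 (a)(b) and its proof (pp. 56–60);
[Howard2004HeegnerKolyvagin] Def. 2.1.6, 2.1.10, Thm. 2.1.11; [Harari2020] Thm. 17.13; [Tate1963DualityICM].
-/

noncomputable section

open Function NumberField IsDedekindDomain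
open scoped NumberField

universe u

set_option linter.dupNamespace false
set_option autoImplicit false

namespace Summit.BirchSwinnertonDyer.BirchSwinnertonDyer.Theorems.PoitouTateShaAnnihilator

open Literature.NumberTheory.GaloisRepresentations
open Literature.NumberTheory.GaloisRepresentations.DiscreteGaloisModule (mu localTatePairingZMod tateDual
  unramifiedSubgroup SelmerStructure)
open Literature.NumberTheory.GaloisCohomology

/-! ## §1 The annihilator of `Ш¹` is the image of `γ¹` -/

section Main

variable {K : Type u} [Field K] [NumberField K] {M : Type u} [AddCommGroup M] [TopologicalSpace M]
  [DiscreteTopology M] [Finite M] {n : ℕ} [NeZero n]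

/-- **The annihilator of `Ш¹` lies in the image of `γ¹` (Milne I Thm. 4.10: the step (b) ⟹ (a)).**  Let
`inv` be a family of local invariant maps with `IsPerfect` (local Tate duality at the finite places),
`UnramifiedOrthogonal` (Milne I Thm. 2.6) and `SelmerComplement` (Howard Thm. 2.1.11); `M` a finite discrete
`Γ_K`-module killed by `n ≥ 1`, unramified outside the finite set of places `S₀ ⊇ {v ∣ ∞} ∪ {v ∣ n}`; and
`φ : H¹(K, M^D) →+ ℤ/n` an additive map vanishing on every class that is locally zero at ALL FINITE places.
Then there are a finite `S₁ ⊇ S₀` and a family `t_v ∈ H¹(K_v, M)` (`v` over all places), zero at the infinite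
places and unramified at the finite places outside `S₁`, such that for every `y ∈ H¹(K, M^D)` and every
finite `S ⊇ S₁` outside which `y` is unramified, `φ(y) = ∑_{v ∈ S} inv_v (t_v ∪ loc_v y)`.
[cite: MilneADT2006, Ch. I, Thm. 4.10 (a)(b) and proof, Lemma 4.8, Cor. 2.3, Thm. 2.6]
[cite: Howard2004HeegnerKolyvagin, Thm. 2.1.11 (arXiv:1202.6340 p. 6)] -/
theorem exists_family_sum_localTatePairing_eq {inv : LocalInvariants K n} (hperf : inv.IsPerfect)
    (hur : inv.UnramifiedOrthogonal) (hcomp : inv.SelmerComplement)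
    (ρ : DiscreteGaloisModule K M) (hM : ∀ m : M, n • m = 0)
    (S₀ : Finset (Place K)) (hinf : ∀ w : InfinitePlace K, (Sum.inl w : Place K) ∈ S₀)
    (hS₀ : ∀ v : HeightOneSpectrum (𝓞 K), (Sum.inr v : Place K) ∉ S₀ →
      ((n : ℕ) : 𝓞 K) ∉ v.asIdeal ∧ GaloisRep.IsUnramifiedAt v ρ)
    (φ : galoisCohomology (ρ.tateDual n) 1 →+ ZMod n)
    (hφ : ∀ y : galoisCohomology (ρ.tateDual n) 1,
      (∀ v : HeightOneSpectrum (𝓞 K),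
        galoisCohomology.localization (ρ.tateDual n) (Sum.inr v) 1 y = 0) → φ y = 0) :
    ∃ (S₁ : Finset (Place K)) (t : Π v : Place K, galoisCohomology (ρ.toLocal v) 1),
      S₀ ⊆ S₁ ∧ (∀ w : InfinitePlace K, t (Sum.inl w) = 0) ∧
      (∀ v : HeightOneSpectrum (𝓞 K), (Sum.inr v : Place K) ∉ S₁ →
        t (Sum.inr v) ∈ unramifiedSubgroup (GaloisRep.toLocal v ρ) 1) ∧
      ∀ (y : galoisCohomology (ρ.tateDual n) 1) (S : Finset (Place K)), S₁ ⊆ S →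
        (∀ v : HeightOneSpectrum (𝓞 K), (Sum.inr v : Place K) ∉ S →
          galoisCohomology.localization (ρ.tateDual n) (Sum.inr v) 1 y ∈
            unramifiedSubgroup (GaloisRep.toLocal v (ρ.tateDual n)) 1) →
        φ y = ∑ v ∈ S, localTatePairingZMod ρ n v (inv v) (t v)
          (galoisCohomology.localization (ρ.tateDual n) v 1 y) := by
  classical
  haveI : Finite (DiscreteGaloisModule.TateDual K M n) := DiscreteGaloisModule.TateDual.finite K M n
  /- Step 1: enlarge `S₀` to `S₁` so that `Ш¹_{S₁}(M) = Ш¹(M)` and `Ш¹_{S₁}(M^D) = Ш¹(M^D)` at the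
  finite places. -/
  obtain ⟨SM, hSM₀, hstabM⟩ :=
    exists_finset_forall_localization_eq_zero ρ S₀ hinf fun v hv => (hS₀ v hv).2
  obtain ⟨SN, hSN₀, hstabN⟩ :=
    exists_finset_forall_localization_eq_zero (ρ.tateDual n) S₀ hinf fun v hv =>
      SchneiderFreeAdditiveX3.PoitouTateReduction.isUnramifiedAt_tateDual ρ v (hS₀ v hv).1 (hS₀ v hv).2
  set S₁ : Finset (Place K) := SM ∪ SN with hS₁def
  have hS₀S₁ : S₀ ⊆ S₁ := hSM₀.trans Finset.subset_union_left
  have hinf₁ : ∀ w : InfinitePlace K, (Sum.inl w : Place K) ∈ S₁ := fun w => hS₀S₁ (hinf w)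
  have hS₁ : ∀ v : HeightOneSpectrum (𝓞 K), (Sum.inr v : Place K) ∉ S₁ →
      ((n : ℕ) : 𝓞 K) ∉ v.asIdeal ∧ GaloisRep.IsUnramifiedAt v ρ :=
    fun v hv => hS₀ v fun h => hv (hS₀S₁ h)
  have hstabM₁ : ∀ x : galoisCohomology ρ 1,
      (∀ v : HeightOneSpectrum (𝓞 K), (Sum.inr v : Place K) ∈ S₁ →
        galoisCohomology.localization ρ (Sum.inr v) 1 x = 0) →
      (∀ v : HeightOneSpectrum (𝓞 K), (Sum.inr v : Place K) ∉ S₁ →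
        galoisCohomology.localization ρ (Sum.inr v) 1 x ∈ unramifiedSubgroup (GaloisRep.toLocal v ρ) 1) →
      ∀ v : HeightOneSpectrum (𝓞 K), galoisCohomology.localization ρ (Sum.inr v) 1 x = 0 := by
    intro x h0 hu
    refine hstabM x (fun v hv => h0 v (Finset.subset_union_left hv)) fun v hv => ?_
    by_cases hv₁ : (Sum.inr v : Place K) ∈ S₁
    · rw [h0 v hv₁]; exact AddSubgroup.zero_mem _
    · exact hu v hv₁
  have hstabN₁ : ∀ y : galoisCohomology (ρ.tateDual n) 1,
      (∀ v : HeightOneSpectrum (𝓞 K), (Sum.inr v : Place K) ∈ S₁ →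
        galoisCohomology.localization (ρ.tateDual n) (Sum.inr v) 1 y = 0) →
      (∀ v : HeightOneSpectrum (𝓞 K), (Sum.inr v : Place K) ∉ S₁ →
        galoisCohomology.localization (ρ.tateDual n) (Sum.inr v) 1 y ∈
          unramifiedSubgroup (GaloisRep.toLocal v (ρ.tateDual n)) 1) →
      ∀ v : HeightOneSpectrum (𝓞 K), galoisCohomology.localization (ρ.tateDual n) (Sum.inr v) 1 y = 0 := by
    intro y h0 hu
    refine hstabN y (fun v hv => h0 v (Finset.subset_union_right hv)) fun v hv => ?_
    by_cases hv₁ : (Sum.inr v : Place K) ∈ S₁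
    · rw [h0 v hv₁]; exact AddSubgroup.zero_mem _
    · exact hu v hv₁
  /- Step 2: on `S₁`, `φ` is `∑_{v ∈ S₁,f} ⟨t¹_v, ·⟩` on the classes unramified off `S₁`. -/
  set Sf : Finset (HeightOneSpectrum (𝓞 K)) := S₁.preimage Sum.inr Sum.inr_injective.injOn with hSfdef
  have hSf : ∀ v : HeightOneSpectrum (𝓞 K), v ∈ Sf ↔ (Sum.inr v : Place K) ∈ S₁ := fun v =>
    Finset.mem_preimage
  obtain ⟨t1, ht1⟩ := exists_sum_localTatePairingZMod_eq_of_unramifiedOutside hperf ρ hM S₁ φ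
    fun y hyur hy0 => hφ y (hstabN₁ y hy0 hyur)
  /- Step 3: off `S₁`, the unramified representatives `t₀ v` of `λ = φ − ∑_{S₁,f} ⟨t¹_v, ·⟩`. -/
  let lam : galoisCohomology (ρ.tateDual n) 1 →+ ZMod n :=
    φ - ∑ v ∈ Sf, (localTatePairingZMod ρ n (Sum.inr v) (inv (Sum.inr v)) (t1 v)).comp
      (galoisCohomology.localization (ρ.tateDual n) (Sum.inr v) 1)
  have hlam : ∀ y, lam y = φ y - ∑ v ∈ Sf, localTatePairingZMod ρ n (Sum.inr v) (inv (Sum.inr v)) (t1 v)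
      (galoisCohomology.localization (ρ.tateDual n) (Sum.inr v) 1 y) := by
    intro y
    simp only [lam, AddMonoidHom.sub_apply, AddMonoidHom.finsetSum_apply, AddMonoidHom.comp_apply]
  have hlam0 : ∀ y : galoisCohomology (ρ.tateDual n) 1,
      (∀ v : HeightOneSpectrum (𝓞 K), (Sum.inr v : Place K) ∉ S₁ →
        galoisCohomology.localization (ρ.tateDual n) (Sum.inr v) 1 y ∈
          unramifiedSubgroup (GaloisRep.toLocal v (ρ.tateDual n)) 1) → lam y = 0 :=
    fun y hy => by rw [hlam, ← ht1 y hy, sub_self]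
  have step3 := fun (v₀ : HeightOneSpectrum (𝓞 K)) (hv₀ : (Sum.inr v₀ : Place K) ∉ S₁) =>
    exists_mem_unramifiedSubgroup_localTatePairingZMod_eq hperf hur hcomp ρ hM S₁ hinf₁ hS₁ hstabM₁ lam
      hlam0 hv₀
  choose t₀ ht₀ur ht₀eq using step3
  -- the family `t`
  let t : Π v : Place K, galoisCohomology (ρ.toLocal v) 1 := fun v =>
    match v with
    | Sum.inl _ => 0
    | Sum.inr v' => if h : (Sum.inr v' : Place K) ∈ S₁ then t1 v' else t₀ v' h
  have ht_inl : ∀ w : InfinitePlace K, t (Sum.inl w) = 0 := fun _ => rfl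
  have ht_in : ∀ v : HeightOneSpectrum (𝓞 K), (Sum.inr v : Place K) ∈ S₁ → t (Sum.inr v) = t1 v :=
    fun v h => by simp only [t, dif_pos h]
  have ht_out : ∀ (v : HeightOneSpectrum (𝓞 K)) (h : (Sum.inr v : Place K) ∉ S₁), t (Sum.inr v) = t₀ v h :=
    fun v h => by simp only [t, dif_neg h]
  /- Step 4: the formula, by induction on the finite set `D` of places outside `S₁` where `y` may
  ramify. -/
  have hPur : ∀ (v : HeightOneSpectrum (𝓞 K)) (h : (Sum.inr v : Place K) ∉ S₁)
      (b : galoisCohomology ((ρ.tateDual n).toLocal (Sum.inr v)) 1),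
      b ∈ unramifiedSubgroup (GaloisRep.toLocal v (ρ.tateDual n)) 1 →
      localTatePairingZMod ρ n (Sum.inr v) (inv (Sum.inr v)) (t (Sum.inr v)) b = 0 := by
    intro v h b hb
    have hb' : b ∈ inv.dualLocalCondition ρ (Sum.inr v) (unramifiedSubgroup (GaloisRep.toLocal v ρ) 1) := by
      rw [(hur ρ hM v (hS₁ v h).1 (hS₁ v h).2).1]
      exact hb
    rw [LocalInvariants.mem_dualLocalCondition_iff] at hb'
    rw [ht_out v h]
    exact hb' _ (ht₀ur v h)
  have key : ∀ D : Finset (HeightOneSpectrum (𝓞 K)), (∀ v ∈ D, (Sum.inr v : Place K) ∉ S₁) →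
      ∀ y : galoisCohomology (ρ.tateDual n) 1,
        (∀ v : HeightOneSpectrum (𝓞 K), (Sum.inr v : Place K) ∉ S₁ → v ∉ D →
          galoisCohomology.localization (ρ.tateDual n) (Sum.inr v) 1 y ∈
            unramifiedSubgroup (GaloisRep.toLocal v (ρ.tateDual n)) 1) →
        φ y = (∑ v ∈ Sf, localTatePairingZMod ρ n (Sum.inr v) (inv (Sum.inr v)) (t1 v)
            (galoisCohomology.localization (ρ.tateDual n) (Sum.inr v) 1 y)) +
          ∑ v ∈ D, localTatePairingZMod ρ n (Sum.inr v) (inv (Sum.inr v)) (t (Sum.inr v))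
            (galoisCohomology.localization (ρ.tateDual n) (Sum.inr v) 1 y) := by
    intro D
    induction D using Finset.induction_on with
    | empty =>
      intro _ y hy
      rw [Finset.sum_empty, add_zero, ht1 y fun v hv => hy v hv (Finset.notMem_empty v)]
    | @insert v₀ D' hv₀D' ih =>
      intro hD y hy
      have hv₀ : (Sum.inr v₀ : Place K) ∉ S₁ := hD v₀ (Finset.mem_insert_self _ _)
      have hD' : ∀ v ∈ D', (Sum.inr v : Place K) ∉ S₁ := fun v hv => hD v (Finset.mem_insert_of_mem hv)
      -- peel off the place `v₀`
      obtain ⟨z, hz, hzy⟩ := exists_localization_sub_mem_unramifiedSubgroup hur hcomp ρ hM S₁ hinf₁ hS₁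
        hstabM₁ hv₀ (galoisCohomology.localization (ρ.tateDual n) (Sum.inr v₀) 1 y)
      have hy' : ∀ v : HeightOneSpectrum (𝓞 K), (Sum.inr v : Place K) ∉ S₁ → v ∉ D' →
          galoisCohomology.localization (ρ.tateDual n) (Sum.inr v) 1 (y - z) ∈
            unramifiedSubgroup (GaloisRep.toLocal v (ρ.tateDual n)) 1 := by
        intro v hv hvD'
        rw [map_sub]
        by_cases hvv : v = v₀
        · subst hvv
          rw [← neg_sub]
          exact AddSubgroup.neg_mem _ hzy
        · exact AddSubgroup.sub_mem _ (hy v hv (by rw [Finset.mem_insert, not_or]; exact ⟨hvv, hvD'⟩))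
            (hz v hv hvv)
      have e1 := ih hD' (y - z) hy'
      have e2 : localTatePairingZMod ρ n (Sum.inr v₀) (inv (Sum.inr v₀)) (t (Sum.inr v₀))
          (galoisCohomology.localization (ρ.tateDual n) (Sum.inr v₀) 1 z) = lam z := by
        rw [ht_out v₀ hv₀]; exact ht₀eq v₀ hv₀ z hz
      rw [hlam] at e2
      -- the pairings against `z` at the places of `D'` vanish, and at `v₀` `z` may be replaced by `y`
      have e3 : ∀ v ∈ D', localTatePairingZMod ρ n (Sum.inr v) (inv (Sum.inr v)) (t (Sum.inr v))
          (galoisCohomology.localization (ρ.tateDual n) (Sum.inr v) 1 z) = 0 := fun v hv =>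
        hPur v (hD' v hv) _ (hz v (hD' v hv) fun h => hv₀D' (h ▸ hv))
      have e4 : localTatePairingZMod ρ n (Sum.inr v₀) (inv (Sum.inr v₀)) (t (Sum.inr v₀))
          (galoisCohomology.localization (ρ.tateDual n) (Sum.inr v₀) 1 (y - z)) = 0 := by
        refine hPur v₀ hv₀ _ ?_
        rw [map_sub, ← neg_sub]
        exact AddSubgroup.neg_mem _ hzy
      rw [Finset.sum_insert hv₀D']
      have e5 : φ y = φ (y - z) + φ z := by rw [← map_add, sub_add_cancel]
      rw [e5, e1]
      simp only [map_sub, Finset.sum_sub_distrib] at e2 e4 ⊢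
      have e6 : ∑ v ∈ D', localTatePairingZMod ρ n (Sum.inr v) (inv (Sum.inr v)) (t (Sum.inr v))
          (galoisCohomology.localization (ρ.tateDual n) (Sum.inr v) 1 z) = 0 :=
        Finset.sum_eq_zero e3
      linear_combination -e2 - e4 - e6
  /- Assembly: read the formula on an arbitrary finite `S ⊇ S₁`. -/
  refine ⟨S₁, t, hS₀S₁, ht_inl, fun v hv => by rw [ht_out v hv]; exact ht₀ur v hv, fun y S hS₁S hy => ?_⟩
  let D : Finset (HeightOneSpectrum (𝓞 K)) := (S \ S₁).preimage Sum.inr Sum.inr_injective.injOn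
  have hD : ∀ v ∈ D, (Sum.inr v : Place K) ∉ S₁ := fun v hv =>
    (Finset.mem_sdiff.1 (Finset.mem_preimage.1 hv)).2
  have hyD : ∀ v : HeightOneSpectrum (𝓞 K), (Sum.inr v : Place K) ∉ S₁ → v ∉ D →
      galoisCohomology.localization (ρ.tateDual n) (Sum.inr v) 1 y ∈
        unramifiedSubgroup (GaloisRep.toLocal v (ρ.tateDual n)) 1 := by
    intro v hv hvD
    refine hy v fun hvS => hvD ?_
    exact Finset.mem_preimage.2 (Finset.mem_sdiff.2 ⟨hvS, hv⟩)
  rw [key D hD y hyD]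
  -- split `∑_{v ∈ S}` as `∑_{v ∈ S₁} + ∑_{v ∈ S ∖ S₁}` and drop the infinite places (`t = 0` there)
  set F : Place K → ZMod n := fun v => localTatePairingZMod ρ n v (inv v) (t v)
    (galoisCohomology.localization (ρ.tateDual n) v 1 y) with hF
  have hFinl : ∀ x ∈ S, x ∉ Set.range (Sum.inr : HeightOneSpectrum (𝓞 K) → Place K) → F x = 0 := by
    intro x _ hx
    cases x with
    | inl w => simp only [hF, ht_inl, map_zero, AddMonoidHom.zero_apply]
    | inr v => exact absurd ⟨v, rfl⟩ hx
  have h1 : ∑ v ∈ S₁, F v = ∑ v ∈ Sf, localTatePairingZMod ρ n (Sum.inr v) (inv (Sum.inr v)) (t1 v)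
      (galoisCohomology.localization (ρ.tateDual n) (Sum.inr v) 1 y) := by
    rw [← Finset.sum_preimage Sum.inr S₁ Sum.inr_injective.injOn F
      (fun x hx hx' => hFinl x (hS₁S hx) hx')]
    refine Finset.sum_congr rfl fun v hv => ?_
    simp only [hF, ht_in v ((hSf v).1 hv)]
  have h2 : ∑ v ∈ S \ S₁, F v = ∑ v ∈ D, localTatePairingZMod ρ n (Sum.inr v) (inv (Sum.inr v))
      (t (Sum.inr v)) (galoisCohomology.localization (ρ.tateDual n) (Sum.inr v) 1 y) := by
    rw [← Finset.sum_preimage Sum.inr (S \ S₁) Sum.inr_injective.injOn F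
      (fun x hx hx' => hFinl x (Finset.mem_sdiff.1 hx).1 hx')]
  rw [← Finset.sum_sdiff hS₁S, h1, h2, add_comm]

end Main

/-! ## §2 Totally complex `K`: the hypothesis is "`φ` vanishes on `Ш¹(K, M^D)`"; packaging with the named fact -/

section TotallyComplex

variable {K : Type u} [Field K] [NumberField K] {M : Type u} [AddCommGroup M] [TopologicalSpace M]
  [DiscreteTopology M]

variable [Finite M] {n : ℕ} [NeZero n]

/-- **The annihilator of `Ш¹(K, M^D)` consists of sums of local Tate pairings — totally complex `K`.**
For `K` totally complex (e.g. imaginary quadratic), a family `inv` with local Tate duality, Milne I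
Thm. 2.6 and Poitou–Tate for Selmer structures (`IsPerfect`, `UnramifiedOrthogonal`, `SelmerComplement`),
a finite discrete `n`-torsion `Γ_K`-module `M` unramified outside the finite `S₀ ⊇ {v ∣ ∞} ∪ {v ∣ n}`, and
EVERY additive `φ : H¹(K, M^D) → ℤ/n` vanishing on `Ш¹(K, M^D)`: there are a finite `S₁ ⊇ S₀` and ONE
family `t = (t_v)_v`, `t_v ∈ H¹(K_v, M)`, zero at the infinite places and unramified off `S₁`, with
`φ(y) = ∑_{v ∈ S} inv_v (t_v ∪ y_v)` for every `y ∈ H¹(K, M^D)` and every finite `S ⊇ S₁` off which `y`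
is unramified.  This is the inclusion `Ш¹(K, M^D)^⊥ ⊆ γ¹(P¹(K, M))` inside `H¹(K, M^D)^*`, i.e. the
algebraic step from the middle exactness `Ker γ¹ = Im β¹` (Milne I 4.10 (b)) to the duality
`Ш²(K, M) ≅ coker γ¹ ≅ Ш¹(K, M^D)^*` (Milne I 4.10 (a)); see `exists_family_sum_localTatePairing_eq`
for arbitrary `K` (hypothesis at the finite places only).
[cite: MilneADT2006, Ch. I, Thm. 4.10 (a)(b) and proof, Lemma 4.8, Thm. 2.6]
[cite: Howard2004HeegnerKolyvagin, Thm. 2.1.11 (arXiv:1202.6340 p. 6)] -/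
theorem exists_family_sum_localTatePairing_eq_of_isTotallyComplex [IsTotallyComplex K]
    {inv : LocalInvariants K n} (hperf : inv.IsPerfect)
    (hur : inv.UnramifiedOrthogonal) (hcomp : inv.SelmerComplement)
    (ρ : DiscreteGaloisModule K M) (hM : ∀ m : M, n • m = 0)
    (S₀ : Finset (Place K)) (hinf : ∀ w : InfinitePlace K, (Sum.inl w : Place K) ∈ S₀)
    (hS₀ : ∀ v : HeightOneSpectrum (𝓞 K), (Sum.inr v : Place K) ∉ S₀ →
      ((n : ℕ) : 𝓞 K) ∉ v.asIdeal ∧ GaloisRep.IsUnramifiedAt v ρ)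
    (φ : galoisCohomology (ρ.tateDual n) 1 →+ ZMod n)
    (hφ : ∀ y ∈ DiscreteGaloisModule.sha (ρ.tateDual n), φ y = 0) :
    ∃ (S₁ : Finset (Place K)) (t : Π v : Place K, galoisCohomology (ρ.toLocal v) 1),
      S₀ ⊆ S₁ ∧ (∀ w : InfinitePlace K, t (Sum.inl w) = 0) ∧
      (∀ v : HeightOneSpectrum (𝓞 K), (Sum.inr v : Place K) ∉ S₁ →
        t (Sum.inr v) ∈ unramifiedSubgroup (GaloisRep.toLocal v ρ) 1) ∧
      ∀ (y : galoisCohomology (ρ.tateDual n) 1) (S : Finset (Place K)), S₁ ⊆ S →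
        (∀ v : HeightOneSpectrum (𝓞 K), (Sum.inr v : Place K) ∉ S →
          galoisCohomology.localization (ρ.tateDual n) (Sum.inr v) 1 y ∈
            unramifiedSubgroup (GaloisRep.toLocal v (ρ.tateDual n)) 1) →
        φ y = ∑ v ∈ S, localTatePairingZMod ρ n v (inv v) (t v)
          (galoisCohomology.localization (ρ.tateDual n) v 1 y) :=
  exists_family_sum_localTatePairing_eq hperf hur hcomp ρ hM S₀ hinf hS₀ φ fun y hy =>
    hφ y (mem_sha_of_forall_localization_inr_eq_zero _ y hy)

/-- **The same from the named fact `poitouTate_selmerStructure_duality K`** (Milne I Cor. 2.3, Thm. 2.6,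
Thm. 4.10 (b), Howard Thm. 2.1.11, for ONE family of local invariant maps): for every level `n ≥ 1` there is
a family `inv` which is a local Tate duality at the finite places, satisfies the Poitou–Tate vanishing
`∑_v ⟨x_v, y_v⟩_v = 0` on global classes, AND represents every functional on `H¹(K, M^D)` vanishing on
`Ш¹(K, M^D)` by sums of local Tate pairings against one adelic family, for every finite `n`-torsion `M`
over the totally complex number field `K`.  CONDITIONAL on the named fact (hypothesis `h`), which cell
`bsd-schneider`'s Route A is discharging; the remaining step to Milne I 4.10 (a) (`poitouTate_sha_tateDual`)
is the identification `Ш²(K, M) ≅ H¹(K, M^D)^* / γ¹(P¹(K, M))` of that route (Tate's `α¹` for `C̄`, readout).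
[cite: MilneADT2006, Ch. I, Thm. 4.10 (a)(b), Cor. 2.3, Thm. 2.6] -/
theorem exists_localInvariants_sha_annihilator_of_poitouTate [IsTotallyComplex K]
    (h : poitouTate_selmerStructure_duality K) (n : ℕ) [NeZero n] :
    ∃ inv : LocalInvariants K n, inv.IsPerfect ∧ inv.SumLocalTermEqZero ∧
      ∀ ⦃M : Type u⦄ [AddCommGroup M] [TopologicalSpace M] [DiscreteTopology M] [Finite M]
        (ρ : DiscreteGaloisModule K M), (∀ m : M, n • m = 0) →
        ∀ (S₀ : Finset (Place K)), (∀ w : InfinitePlace K, (Sum.inl w : Place K) ∈ S₀) →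
        (∀ v : HeightOneSpectrum (𝓞 K), (Sum.inr v : Place K) ∉ S₀ →
          ((n : ℕ) : 𝓞 K) ∉ v.asIdeal ∧ GaloisRep.IsUnramifiedAt v ρ) →
        ∀ φ : galoisCohomology (ρ.tateDual n) 1 →+ ZMod n,
          (∀ y ∈ DiscreteGaloisModule.sha (ρ.tateDual n), φ y = 0) →
          ∃ (S₁ : Finset (Place K)) (t : Π v : Place K, galoisCohomology (ρ.toLocal v) 1),
            S₀ ⊆ S₁ ∧ (∀ w : InfinitePlace K, t (Sum.inl w) = 0) ∧
            (∀ v : HeightOneSpectrum (𝓞 K), (Sum.inr v : Place K) ∉ S₁ →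
              t (Sum.inr v) ∈ unramifiedSubgroup (GaloisRep.toLocal v ρ) 1) ∧
            ∀ (y : galoisCohomology (ρ.tateDual n) 1) (S : Finset (Place K)), S₁ ⊆ S →
              (∀ v : HeightOneSpectrum (𝓞 K), (Sum.inr v : Place K) ∉ S →
                galoisCohomology.localization (ρ.tateDual n) (Sum.inr v) 1 y ∈
                  unramifiedSubgroup (GaloisRep.toLocal v (ρ.tateDual n)) 1) →
              φ y = ∑ v ∈ S, localTatePairingZMod ρ n v (inv v) (t v)
                (galoisCohomology.localization (ρ.tateDual n) v 1 y) := by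
  obtain ⟨inv, hperf, hvan, hur, hcomp⟩ := h n
  exact ⟨inv, hperf, hvan, fun M _ _ _ _ ρ hM S₀ hinf hS₀ φ hφ =>
    exists_family_sum_localTatePairing_eq_of_isTotallyComplex hperf hur hcomp ρ hM S₀ hinf hS₀ φ hφ⟩

end TotallyComplex

end Summit.BirchSwinnertonDyer.BirchSwinnertonDyer.Theorems.PoitouTateShaAnnihilator

end
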